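import Summits.KontsevichZagierPeriods.KontsevichZagierPeriods.Theses.HurwitzMicroSectors
import Literature.NumberTheory.Transcendental.BoxCoordinatePowerMap

/-!
# `DilationMove` (stmt-KontsevichZagierPeriods-3872, route HurwitzMicroSectors) — line
`coordpow-api-assembly`, stub `stub_orthantCoordPowMove`

The coordinatewise power map `Φₘ x = (xᵢᵐ)ᵢ` (`BoxIntegral.coordPow m`) with its derivative
`Φₘ'(x) = diag(m xᵢ^(m-1))` (`BoxIntegral.coordPowDeriv m x`) is ONE change-of-variables generator of
the Kontsevich–Zagier calculus on every domain `σ = r.domain` contained in the open orthant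
`{x | ∀ i, 0 < xᵢ}` (`m ≥ 1`): it is injective there (`BoxIntegral.injOn_coordPow`, strict
monotonicity of `t ↦ tᵐ` on `[0,∞)`), differentiable (`BoxIntegral.hasFDerivWithinAt_coordPow`), and
its Jacobian `det Φₘ'(x) = mⁿ ∏ᵢ xᵢ^(m-1)` (`BoxIntegral.det_coordPowDeriv`) is positive on the
orthant, so `|det| = mⁿ ∏ᵢ xᵢ^(m-1)` is exactly the factor of the crux. Semialgebraicity of `Φₘ` on
`σ` and the target domain `r'.domain = Φₘ '' σ` are taken as data (they are the other stub /
the composition's business). [Kontsevich–Zagier 2001, §1.2, rule (2)]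
-/

noncomputable section

open Set MeasureTheory
open Literature.NumberTheory.Transcendental
open Literature.ModelTheory.ExponentialFields (IsSemialgebraic)

namespace Summit.KontsevichZagierPeriods.HurwitzMicroSectors.DilationMove

/-- On the open orthant the Jacobian of `Φₘ` is positive: `0 < mⁿ ∏ᵢ xᵢ^(m-1)` for `m ≠ 0` and
`xᵢ > 0`. [folklore] -/
theorem det_coordPowDeriv_pos_of_pos {n m : ℕ} (hm : m ≠ 0) {x : Fin n → ℝ}
    (hx : ∀ i, 0 < x i) : 0 < (BoxIntegral.coordPowDeriv m x).det := by
  rw [BoxIntegral.det_coordPowDeriv]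
  have hm' : (0 : ℝ) < m := by exact_mod_cast Nat.pos_of_ne_zero hm
  exact mul_pos (pow_pos hm' n) (Finset.prod_pos fun i _ => pow_pos (hx i) _)

/-- **The orthant dilation move** (registered stub `stub_orthantCoordPowMove` of crux
stmt-KontsevichZagierPeriods-3872). For `m ≥ 1`, a representation `r` with `r.domain` inside the
open orthant on which `Φₘ = BoxIntegral.coordPow m` is `ℚ`-semialgebraic, and a representation `r'`
with `r'.domain = Φₘ '' r.domain` and `r.integrand x = r'.integrand (Φₘ x) · mⁿ ∏ᵢ xᵢ^(m-1)` on
`r.domain`, the difference `[r] − [r']` lies in `KZ.changeOfVariablesRel` — witness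
`(Φ, Φ') = (Φₘ, Φₘ')`. [Kontsevich–Zagier 2001, §1.2, rule (2)] -/
theorem stub_orthantCoordPowMove :
    ∀ (n m : ℕ), 1 ≤ m → ∀ (r r' : KZ.IntegralRep n), r.domain ⊆ {x | ∀ i, 0 < x i} →
      IsSemialgebraicMapOn ℚ r.domain (fun x : Fin n → ℝ => BoxIntegral.coordPow m x) →
      r'.domain = (fun x : Fin n → ℝ => BoxIntegral.coordPow m x) '' r.domain →
      (∀ x ∈ r.domain, r.integrand x =
        r'.integrand (BoxIntegral.coordPow m x) * ((m : ℝ) ^ n * ∏ i, x i ^ (m - 1))) →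
      KZ.of r - KZ.of r' ∈ KZ.changeOfVariablesRel := by
  intro n m hm r r' hsub hsa hdom hint
  have hm0 : m ≠ 0 := by omega
  refine ⟨n, r, r', fun x => BoxIntegral.coordPow m x, fun x => BoxIntegral.coordPowDeriv m x,
    hsa, fun x _ => BoxIntegral.hasFDerivWithinAt_coordPow m r.domain x, ?_, hdom, ?_, rfl⟩
  · exact (BoxIntegral.injOn_coordPow hm0).mono fun x hx i => (hsub hx i).le
  · intro x hx
    rw [hint x hx, abs_of_pos (det_coordPowDeriv_pos_of_pos hm0 (hsub hx)),
      BoxIntegral.det_coordPowDeriv]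

end Summit.KontsevichZagierPeriods.HurwitzMicroSectors.DilationMove
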